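import Literature.RepresentationTheory.CharacterIsotypicSubspace
import Mathlib.LinearAlgebra.TensorProduct.Basic
import Mathlib.Topology.Algebra.Module.Basic
import HarnessLib

/-!
# Weight spaces: pure tensors, spans and closures

Topic `RepresentationTheory`; namespace `Literature.RepresentationTheory`.  Three bookkeeping lemmas over the tree's
`weightSpace ρ ι w` (`CharacterIsotypicSubspace`: the joint eigenspace `{v | ∀ t, ρ (ι t) v = w t • v}`), proved from
Mathlib only: **no named facts, no records, 0 proof holes**.

* `tmul_mem_weightSpace`: if `ρ (ι t)` acts on pure tensors of a tensor model `E : M ⊗ N ≃ V` factor by factor,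
  `ρ (ι t) (E (x ⊗ y)) = E (A t x ⊗ B t y)`, and `x`, `y` are eigenvectors of the factors with eigenvalues `a t`, `b t`
  with `a t * b t = w t`, then `E (x ⊗ y)` is a weight vector of weight `w`;
* `span_le_weightSpace`: a span of weight vectors lies in the weight space;
* `topologicalClosure_span_le_weightSpace`: so does its closure when the operators `ρ (ι t)` are continuous
  (`isClosed_weightSpace`).

Use (pub-hodgecm model cell, rows A12/A34 and `SK = 𝒮^κ`): with `V = 𝒮(𝔸)` in the tensor model
`piSchwartzBruhatEquiv : 𝒮_∞ ⊗ 𝒮_f ≃ 𝒮(𝔸)`, the archimedean eigen-equations of `Weil1964/ArchFollandCompactKType`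
(`arch_compact_apply_follandFock_of_linSubst_eq_smul`) and the finite-side scalar of the `K_∞ × 1` implementers make
every printed pure tensor `ins f φ = E (follandFock e_D φ ⊗ Φ_f)` a `κ`-weight vector (`UnitaryGroup.kappaIsotypic` IS a
`weightSpace`), and `SK :=` the closure of their span is then contained in `𝒮^κ` — the shape binder rows gen12/real34 ask.
Nothing about those objects is asserted here.

## Mathlib / tree

Mathlib: `TensorProduct.smul_tmul_smul`/`smul_tmul'`, `map_smul`, `Submodule.span_le`,
`Submodule.topologicalClosure_minimal`.
Tree: `weightSpace`, `mem_weightSpace`, `isClosed_weightSpace`.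

## Provenance

Written under the LEAN-IN-TREE rule (2026-08-18) for the pub-hodgecm formalisation cell (binder-2 lane gen 4, STEP 3 (d)
census glue).  KERNEL only. [folklore]
-/

set_option autoImplicit false

open scoped TensorProduct

namespace Literature.RepresentationTheory

variable {R : Type*} [CommRing R] {G : Type*} [Monoid G] {V : Type*} [AddCommGroup V] [Module R V]
variable {ρ : Representation R G V} {T : Type*} {ι : T → G} {w : T → R}

/-- **Pure tensors of eigenvectors are weight vectors.**  In a tensor model `E : M ⊗ N ≃ₗ V` in which every
`ρ (ι t)` acts factor by factor through `A t ⊗ B t` on pure tensors, a pure tensor of eigenvectors of `A t` and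
`B t` (eigenvalues `a t`, `b t`, `a t * b t = w t`) lies in `weightSpace ρ ι w`. [folklore] -/
theorem tmul_mem_weightSpace {M N : Type*} [AddCommGroup M] [Module R M] [AddCommGroup N] [Module R N]
    (E : M ⊗[R] N ≃ₗ[R] V) (A : T → M →ₗ[R] M) (B : T → N →ₗ[R] N)
    (hρ : ∀ (t : T) (x : M) (y : N), ρ (ι t) (E (x ⊗ₜ y)) = E (A t x ⊗ₜ B t y))
    {x : M} {y : N} {a b : T → R} (hx : ∀ t, A t x = a t • x) (hy : ∀ t, B t y = b t • y)
    (hw : ∀ t, a t * b t = w t) :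
    E (x ⊗ₜ y) ∈ weightSpace ρ ι w := by
  rw [mem_weightSpace]
  intro t
  rw [hρ, hx, hy, TensorProduct.smul_tmul_smul, hw, map_smul]

/-- The special case of a trivial (scalar `b t`) action on the second factor written as `B t = b t • id`.
[folklore] -/
theorem tmul_mem_weightSpace_of_snd_smul {M N : Type*} [AddCommGroup M] [Module R M] [AddCommGroup N] [Module R N]
    (E : M ⊗[R] N ≃ₗ[R] V) (A : T → M →ₗ[R] M) (b : T → R)
    (hρ : ∀ (t : T) (x : M) (y : N), ρ (ι t) (E (x ⊗ₜ y)) = E (A t x ⊗ₜ (b t • y)))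
    {x : M} {a : T → R} (hx : ∀ t, A t x = a t • x) (hw : ∀ t, a t * b t = w t) (y : N) :
    E (x ⊗ₜ y) ∈ weightSpace ρ ι w :=
  tmul_mem_weightSpace E A (fun t => b t • LinearMap.id) (fun t x y => by rw [hρ]; rfl) hx
    (fun t => rfl) hw

/-- **A span of weight vectors lies in the weight space.** [folklore] -/
theorem span_le_weightSpace {s : Set V} (hs : ∀ v ∈ s, v ∈ weightSpace ρ ι w) :
    Submodule.span R s ≤ weightSpace ρ ι w :=
  Submodule.span_le.mpr hs

/-- **… and so does its closure** when every `ρ (ι t)` is continuous (the weight space is closed).  This is the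
shape `SK := closure (span (printed pure tensors)) ⊆ 𝒮^κ`. [folklore] -/
theorem topologicalClosure_span_le_weightSpace [TopologicalSpace V] [T2Space V] [ContinuousConstSMul R V]
    [ContinuousAdd V] (hc : ∀ t, Continuous (ρ (ι t))) {s : Set V}
    (hs : ∀ v ∈ s, v ∈ weightSpace ρ ι w) :
    (Submodule.span R s).topologicalClosure ≤ weightSpace ρ ι w :=
  Submodule.topologicalClosure_minimal _ (span_le_weightSpace hs) (isClosed_weightSpace hc)

/-- Membership form: every element of the closure of the span of weight vectors is a weight vector. [folklore] -/
theorem mem_weightSpace_of_mem_topologicalClosure_span [TopologicalSpace V] [T2Space V]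
    [ContinuousConstSMul R V] [ContinuousAdd V] (hc : ∀ t, Continuous (ρ (ι t))) {s : Set V}
    (hs : ∀ v ∈ s, v ∈ weightSpace ρ ι w) {v : V} (hv : v ∈ (Submodule.span R s).topologicalClosure) :
    v ∈ weightSpace ρ ι w :=
  topologicalClosure_span_le_weightSpace hc hs hv

end Literature.RepresentationTheory
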